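import Literature.Computability.AlgebraicComplexity.BI17TableauInvariantsSpanReduction
import Literature.Computability.AlgebraicComplexity.BI17WordBlockSignSums
import Literature.Computability.AlgebraicComplexity.BI17TableauPolarizationCount
import HarnessLib

/-!
# The tableau invariants `P_T` in the word model, and BI 2017 Rem. 3.13 discharged

P. Bürgisser, C. Ikenmeyer, *Fundamental invariants of orbit closures*, J. Algebra **477** (2017)
390–434 = arXiv:1511.02927 [BurgisserIkenmeyer2017], §3.1 eq. (3.4) and Rem. 3.13 (TeX `main.tex`
L1007, L1100; held text `paper:arxiv-1511.02927` p0009–p0010): "The degree `d` invariant space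
`O(Sym^D ℂ^m)_d^{SL_m}` is generated by the set of all invariants `P_T`, where `T` runs over all
semistandard tableaux of shape `m × s` with exactly `D` entries of each number `1,…,d`." Typed
(val-lit row BI2017-A, t04) as the named fact `BI2017_rem_3_13` of
`BI17FundamentalInvariantForms.lean` (weaker form: `β` over all bijections `[D] × [d] ≃ [m] × [s]`).

THEOREM-ONLY file (no definitions, no named facts). It supplies the last step ("S3", the assembly)
of the word-model route laid out in `BI17TableauInvariantsSpanReduction.lean` (val-lit t06 g3):

* `wordOfForm_tableauInvPoly_eq_smul_sum_wordPerm_wordBlockSign` — **THE DICTIONARY IDENTITY**: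
  for a block structure `e : [dD] ≃ [s] × [m]` (position ↦ (column, row)) let `β_e : [D] × [d] ≃
  [m] × [s]`, `β_e (ι, i) = (row, column)` of the position `(i, ι)` (block `i`, place `ι`). Then the
  transported full polarisation of the tableau invariant `P_{β_e}` (BI eq. (3.4), letters renamed by
  `ρ ∈ S_m`) is the wreath average of the block sign `ζ_e`:
  `wordOfForm ρ D d (P_{β_e}) = (sgn ρ)^s / (d!·D!^d) • ∑_{(π,ε) ∈ S_d × S_D^d} (outer π · inner ε) · ζ_e`.
  Proof = the printed construction of `P_T` read through the polarisation: expand (3.4) as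
  `∑_σ (∏ sgn σ_j) ∏_i v(…)` (`tableauInv`), polarise each product of normalised coordinate
  functions into a count over `S_d × S_D^d` (t06's `polarize_prod_symArrayPoly`, the
  orbit–stabiliser step), exchange the two sums, and recognise `∑_σ (∏ sgn σ_j)[w = σ blockwise]`
  as the block sign (t06's `sum_prod_sign_mul_ite_eq_wordBlockSign`, `wordBlockSign_perm_comp`).
* `BI2017_rem_3_13_holds : BI2017_rem_3_13` — the named fact, by t06's reduction
  `BI2017_rem_3_13_of_wreath_dictionary` fed with the identity (the scalar is nonzero in
  characteristic `0`).

Honest framing: classical invariant theory bookkeeping for the cell `val-lit`; VP ≠ VNP is NOT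
proved and nothing here bears on it.

## References

* [BurgisserIkenmeyer2017] P. Bürgisser, C. Ikenmeyer, J. Algebra 477 (2017) 390–434 =
  arXiv:1511.02927, §3.1 eq. (3.4), Rem. 3.13 (cf. C. Ikenmeyer, PhD thesis 2012, §3(A)).
* [BurgisserIkenmeyerPanovaJAMS2019] P. Bürgisser, C. Ikenmeyer, G. Panova, J. AMS 32 (2019), §4
  (4.1) (the word model `Sym^d Sym^D V = (V^{⊗ dD})^{S_d ≀ S_D}`).
-/

noncomputable section

open MvPolynomial Literature.NumberTheory.DiophantineGeometry

namespace Literature.Computability.AlgebraicComplexity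

/-! ### S3: the tableau invariant `P_{β_e}` polarised is the wreath average of the block sign `ζ_e` -/

section Dictionary

variable (k : Type*) [Field k] [CharZero k] {D d m s : ℕ}

/-- The position permutation `outerBlockPerm π * innerBlockPerm ε` sends the place `ι` of block
`i` to the place `ε_i ι` of block `π i`. [cite: BurgisserIkenmeyerPanovaJAMS2019, §4] -/
theorem outerBlockPerm_mul_innerBlockPerm_apply (ω : Equiv.Perm (Fin d) × (Fin d → Equiv.Perm (Fin D)))
    (i : Fin d) (ι : Fin D) :
    (outerBlockPerm d D ω.1 * innerBlockPerm d D ω.2) (finProdFinEquiv (i, ι)) =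
      finProdFinEquiv (ω.1 i, ω.2 i ι) := by
  rw [Equiv.Perm.mul_apply, innerBlockPerm_apply, outerBlockPerm_apply]

/-- **The dictionary identity behind BI 2017 Rem. 3.13** (eq. (3.4) in the word model). For a
block structure `e : [dD] ≃ [s] × [m]` of the `dD` positions (position ↦ (column, row) of an
`m × s` rectangle) let `β_e : [D] × [d] ≃ [m] × [s]` send `(ι, i)` to (row, column) of the position
`finProdFinEquiv (i, ι)` (place `ι` of block `i`) — the bijection `(ι,i) ↦ (T^{ι,i}, T_{ι,i})` of
BI 2017 eq. (3.2) for the tableau attached to `e`. Then for every `ρ ∈ S_m` the transported full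
polarisation (`wordOfForm ρ D d`, BIP (4.1)) of the tableau invariant
`P_{β_e} = ∑_{σ_1,…,σ_s ∈ S_m} [∏_j sgn σ_j] ∏_{i=1}^d v(σ_{T_{1,i}}(T^{1,i}), …, σ_{T_{D,i}}(T^{D,i}))`
(eq. (3.4), L1007) is `(sgn ρ)^s / (d!·D!^d)` times the wreath average
`∑_{(π, ε) ∈ S_d × S_D^d} (outerBlockPerm π * innerBlockPerm ε) · ζ_e` of the block sign `ζ_e`
(`wordBlockSign`, the coordinate function of `(e_1 ∧ ⋯ ∧ e_m)^{⊗ s}`): each summand of (3.4)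
polarises to the count `#{(π,ε) | w_{π i} ∘ ε_i = σ-block i} / (d!·D!^d)`
(`polarize_prod_symArrayPoly`), and after exchanging the sums `∑_σ [∏ sgn σ_j][w = σ blockwise]`
is `ζ_e(w)` (`sum_prod_sign_mul_ite_eq_wordBlockSign`); the renaming `ρ` of the letters costs
`(sgn ρ)^s` (`wordBlockSign_perm_comp`). [cite: BurgisserIkenmeyer2017, eq. (3.4) and Rem. 3.13] -/
theorem wordOfForm_tableauInvPoly_eq_smul_sum_wordPerm_wordBlockSign (ρ : Equiv.Perm (Fin m))
    (e : Fin (d * D) ≃ Fin s × Fin m) :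
    wordOfForm ρ D d (tableauInvPoly (k := k) D
        (((Equiv.prodComm (Fin D) (Fin d)).trans finProdFinEquiv).trans
          (e.trans (Equiv.prodComm (Fin s) (Fin m)))) (id : Fin m → Fin m)) =
      ((((Equiv.Perm.sign ρ : ℤ) : k) ^ s) / ((Nat.factorial d : k) * (Nat.factorial D : k) ^ d)) •
        ∑ ω : Equiv.Perm (Fin d) × (Fin d → Equiv.Perm (Fin D)),
          wordPerm k (outerBlockPerm d D ω.1 * innerBlockPerm d D ω.2) (wordBlockSign k e) := by
  classical
  set β : Fin D × Fin d ≃ Fin m × Fin s :=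
    ((Equiv.prodComm (Fin D) (Fin d)).trans finProdFinEquiv).trans
      (e.trans (Equiv.prodComm (Fin s) (Fin m))) with hβ
  have hβ1 : ∀ (ι : Fin D) (i : Fin d), (β (ι, i)).1 = (e (finProdFinEquiv (i, ι))).2 := fun ι i => rfl
  have hβ2 : ∀ (ι : Fin D) (i : Fin d), (β (ι, i)).2 = (e (finProdFinEquiv (i, ι))).1 := fun ι i => rfl
  -- the words `J_σ i` of eq. (3.4) and the sign coefficients
  set J : (Fin s → Equiv.Perm (Fin m)) → Fin d → Fin D → Fin m :=
    fun σ i ι => σ (β (ι, i)).2 (β (ι, i)).1 with hJ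
  set c : (Fin s → Equiv.Perm (Fin m)) → k := fun σ => ∏ j, ((Equiv.Perm.sign (σ j) : ℤ) : k)
    with hc
  set τ : Equiv.Perm (Fin d) × (Fin d → Equiv.Perm (Fin D)) → Equiv.Perm (Fin (d * D)) :=
    fun ω => outerBlockPerm d D ω.1 * innerBlockPerm d D ω.2 with hτ
  set K : k := (Nat.factorial d : k) * (Nat.factorial D : k) ^ d with hK
  have hK0 : K ≠ 0 := mul_ne_zero (Nat.cast_ne_zero.mpr (Nat.factorial_ne_zero d))
    (pow_ne_zero _ (Nat.cast_ne_zero.mpr (Nat.factorial_ne_zero D)))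
  -- (1) expand the tableau invariant: `P_β = ∑_σ c_σ • ∏_i symArrayPoly D id (J σ i)`
  have hcast : ∀ σ : Fin s → Equiv.Perm (Fin m),
      (∏ j, ((Equiv.Perm.sign (σ j) : ℤ) : MvPolynomial (DegIdx (Fin m) D) k)) = C (c σ) := by
    intro σ
    rw [hc]
    simp only [map_prod, map_intCast]
  have hP : tableauInvPoly (k := k) D β (id : Fin m → Fin m) =
      ∑ σ : Fin s → Equiv.Perm (Fin m), c σ • ∏ i, symArrayPoly (k := k) D id (J σ i) := by
    unfold tableauInvPoly tableauInv
    refine Finset.sum_congr rfl fun σ _ => ?_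
    rw [smul_eq_C_mul, ← hcast σ]
  funext w
  -- (2) the left-hand side as a double sum of indicators
  set u : Fin d → Fin D → Fin m := fun r p => ρ (w (finProdFinEquiv (r, p))) with hu
  have hcond : ∀ (σ : Fin s → Equiv.Perm (Fin m)) (ω : Equiv.Perm (Fin d) × (Fin d → Equiv.Perm (Fin D))),
      (∀ i, u (ω.1 i) ∘ ⇑(ω.2 i) = id ∘ J σ i) ↔
        ∀ q, (⇑ρ ∘ (w ∘ ⇑(τ ω))) q = σ (e q).1 (e q).2 := by
    intro σ ω
    constructor
    · intro h q
      obtain ⟨⟨i, ι⟩, rfl⟩ := finProdFinEquiv.surjective q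
      have hi := congrFun (h i) ι
      simp only [Function.comp_apply, id] at hi
      rw [Function.comp_apply, Function.comp_apply, hτ, outerBlockPerm_mul_innerBlockPerm_apply]
      rw [hu] at hi
      simp only at hi
      rw [hi]
      exact rfl
    · intro h i
      funext ι
      have hq := h (finProdFinEquiv (i, ι))
      rw [Function.comp_apply, Function.comp_apply, hτ, outerBlockPerm_mul_innerBlockPerm_apply] at hq
      simp only [Function.comp_apply, id]
      rw [hu]
      simp only
      rw [hq]
      exact rfl
  have hS1 : ∀ σ : Fin s → Equiv.Perm (Fin m),
      polarize D d (∏ i, symArrayPoly (k := k) D id (J σ i)) u =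
        (∑ ω : Equiv.Perm (Fin d) × (Fin d → Equiv.Perm (Fin D)),
          if ∀ q, (⇑ρ ∘ (w ∘ ⇑(τ ω))) q = σ (e q).1 (e q).2 then (1 : k) else 0) / K := by
    intro σ
    rw [polarize_prod_symArrayPoly (k := k) id (J σ) u, Finset.card_filter]
    push_cast
    congr 1
    refine Finset.sum_congr rfl fun ω _ => ?_
    rw [if_congr (hcond σ ω) rfl rfl]
  have hL : wordOfForm ρ D d (tableauInvPoly (k := k) D β (id : Fin m → Fin m)) w =
      (∑ ω : Equiv.Perm (Fin d) × (Fin d → Equiv.Perm (Fin D)),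
        wordBlockSign k e (⇑ρ ∘ (w ∘ ⇑(τ ω)))) / K := by
    rw [wordOfForm_apply, hP, ← polarizeLin_apply, map_sum, Finset.sum_apply]
    simp only [map_smul, Pi.smul_apply, smul_eq_mul, polarizeLin_apply]
    change ∑ σ, c σ * polarize D d (∏ i, symArrayPoly (k := k) D id (J σ i)) u = _
    simp only [hS1, ← mul_div_assoc]
    rw [← Finset.sum_div]
    congr 1
    simp only [Finset.mul_sum]
    rw [Finset.sum_comm]
    refine Finset.sum_congr rfl fun ω _ => ?_
    exact sum_prod_sign_mul_ite_eq_wordBlockSign k e _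
  -- (3) rename the letters and read off the wreath average
  rw [hL, Pi.smul_apply, Finset.sum_apply, smul_eq_mul]
  simp only [wordPerm_apply, wordBlockSign_perm_comp k e ρ]
  rw [← Finset.mul_sum, div_mul_eq_mul_div, mul_div_assoc]

end Dictionary

/-! ### Rem. 3.13 discharged -/

/-- **Bürgisser–Ikenmeyer 2017, Rem. 3.13 — DISCHARGED** (`theorem BI2017_rem_3_13_holds :
BI2017_rem_3_13`): every homogeneous `SL_m`-invariant of degree `d` on `Sym^D ℂ^m` (`m ≥ 1`) is a
`ℂ`-linear combination of the tableau invariants `P_β`, `β` ranging over the bijections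
`[D] × [d] ≃ [m] × [s]` ("The degree `d` invariant space `O(Sym^D ℂ^m)_d^{SL_m}` is generated by
the set of all invariants `P_T`", L1100; typed in the weaker form without "semistandard"). Proof:
t06's reduction `BI2017_rem_3_13_of_wreath_dictionary` (scalar `SL_m` for `m ∤ Dd`; otherwise the
polarisation of an invariant is a wreath-invariant highest-weight vector of rectangular weight,
which lies in the span of the block signs `ζ_e` by Schur–Weyl, BI App. Cor. 7.2) fed with the
dictionary identity `wordOfForm_tableauInvPoly_eq_smul_sum_wordPerm_wordBlockSign` divided by its
nonzero scalar `(sgn rev)^s / (d!·D!^d)`. [cite: BurgisserIkenmeyer2017, Rem. 3.13] -/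
theorem BI2017_rem_3_13_holds : BI2017_rem_3_13 := by
  refine BI2017_rem_3_13_of_wreath_dictionary fun D d m s _ _ e => ?_
  classical
  set C : ℂ := ((((Equiv.Perm.sign (Fin.revPerm : Equiv.Perm (Fin m)) : ℤ) : ℂ) ^ s) /
      ((Nat.factorial d : ℂ) * (Nat.factorial D : ℂ) ^ d)) with hC
  have hC0 : C ≠ 0 := by
    refine div_ne_zero (pow_ne_zero _ (Int.cast_ne_zero.mpr (Units.ne_zero _)))
      (mul_ne_zero (Nat.cast_ne_zero.mpr (Nat.factorial_ne_zero d))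
        (pow_ne_zero _ (Nat.cast_ne_zero.mpr (Nat.factorial_ne_zero D))))
  refine ⟨C⁻¹ • tableauInvPoly (k := ℂ) D
      (((Equiv.prodComm (Fin D) (Fin d)).trans finProdFinEquiv).trans
        (e.trans (Equiv.prodComm (Fin s) (Fin m)))) (id : Fin m → Fin m),
    Submodule.smul_mem _ _ (Submodule.subset_span ⟨s, _, rfl⟩), ?_⟩
  rw [wordOfForm_smul, wordOfForm_tableauInvPoly_eq_smul_sum_wordPerm_wordBlockSign ℂ Fin.revPerm e,
    smul_smul, ← hC, inv_mul_cancel₀ hC0, one_smul]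

end Literature.Computability.AlgebraicComplexity

end
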